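import Literature.NumberTheory.EllipticCurves.Rank1Residual.GVParityIsogenyClassProofs
import HarnessLib

/-!
# The Greenberg–Vatsal type under quadratic twists unramified at `p`: even twists preserve it, odd
# twists swap it (iff); type A / B certified by a rational `p`-torsion point on a twist

HONEST FRAMING (cell `b2b-bsdres`, home `run/shared/lean/b2b/bsd-rank1-residual/`): the cell deletes
COMBINATION-SHAPED residual classes of the rank-`≤ 1` BSD formula from PUBLISHED theorems only and
types the rest; this is not "finishing BSD". `Proofs`-style file (theorems only, no definition, no
named fact), prover x1a gen 3; sequel of `GVParityTwistProofs.lean` (gen 1: the one-directional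
twist law `¬ GVPar W p → GVPar W^{(d)} p` for `d < 0`) and of `GVParityLineTypeProofs.lean` /
`GVParityIsogenyClassProofs.lean` (gen 3: the type of a line is independent of the line; torsion
criterion; isogeny classes).

The TWIST LAW of `b2b-bsdres-x1a/X1-CENSUS-g2.md` §0 / CGLS §5 in full: along the isomorphism
`E^{(d)}(ℚ̄) ≃ E(ℚ̄)`, `σ`-equivariant up to the sign `σ√d/√d` (Silverman *AEC* X.5 Cor. 5.4; tree
`exists_addEquiv_geomPoints_quadraticTwist_sign`), rational lines of `E^{(d)}[p]` and of `E[p]`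
correspond; for `p ∤ d` (so `p ∤ 4d`, `p` odd) inertia above `p` fixes `√d` and the correspondence
preserves (un)ramification at `p`; complex conjugation fixes `√d` for `d > 0` and negates it for
`d < 0`, so parity is preserved, resp. swapped. Hence (no reduction hypothesis unless stated):

* `gvPar_twist_iff_of_pos` — **even twist (`d > 0`, `p ∤ d`): `GVPar W^{(d)} p ↔ GVPar W p`.**
* `gvPar_twist_iff_exists_coType_of_neg` — odd twist (`d < 0`, `p ∤ d`): `GVPar W^{(d)} p` iff `E`
  has a rational line of CO-type ((unramified ∧ even) ∨ (ramified ∧ odd)); and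
  `gvPar_twist_iff_not_gvPar_of_neg` — at a good ordinary odd `p` with `E[p]` reducible (globally
  minimal `W`): **`GVPar W^{(d)} p ↔ ¬ GVPar W p`** (the iff form of gen 1's
  `gvPar_of_not_gvPar_of_twist`; "E ↦ E^K swaps A ↔ B").
* Torsion certificates through a twist: `gvPar_of_twist_neg_of_nsmul_eq_zero` — a rational point of
  order `p` on the ODD twist `W^{(d)}` (`d < 0`, `p ∤ d`) makes `E` of type B (`GVPar W p`), with no
  hypothesis on `E`; `not_gvPar_of_twist_pos_of_nsmul_eq_zero` — a rational point of order `p` on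
  the EVEN twist (`d > 0`, `p ∤ d`) makes `E` of type A at a good ordinary odd `p`; and the versions
  with the torsion point on a curve ISOGENOUS to the twist
  (`gvPar_of_isIsogenous_twist_neg_of_nsmul_eq_zero`, `not_gvPar_of_isIsogenous_twist_pos_of_nsmul_eq_zero`).
  On the census (X1-CENSUS-g2.md §2d; all 1524 X1 classes `N < 2·10⁴`): 1438 type-A classes carry a
  rational `p`-torsion point themselves (`GVParityLineTypeProofs`); the 49 remaining type-A classes
  (unramified constituent a non-trivial EVEN character, at `p = 3` a real quadratic `χ_d`,
  `(d/3) = 1`: e.g. `1690h1@3`, `3380e1@3`, `13690l1@3` — conductors `2·5·13²`, `4·5·13²`,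
  `2·5·37²`) and the 37 type-B classes (unramified constituent ODD) are the targets of the even /
  odd twist certificates.

## References
* J. H. Silverman, *AEC*, X.5 Cor. 5.4, X.2 Prop. 2.4. [SilvermanAEC2009]
* F. Castella, G. Grossi, J. Lee, C. Skinner, Invent. Math. 227 (2022), proof of Thm. 5.3.1 (the
  twist `E^K` satisfies the Greenberg–Vatsal hypothesis). [CastellaEtAl2021]
* R. Greenberg, V. Vatsal, Invent. Math. 142 (2000), Thm. (1.3) and the remarks after it ("The
  hypotheses are also preserved by even quadratic twists of conductor prime to `p`").
  [GreenbergVatsal2000]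
-/

set_option autoImplicit false

noncomputable section

open scoped Classical

open WeierstrassCurve Literature.NumberTheory.EllipticCurves Literature.NumberTheory.GaloisRepresentations
  Literature.NumberTheory.EllipticCurves.ModularForms Field IsDedekindDomain NumberField

namespace Literature.NumberTheory.EllipticCurves.Rank1Residual

variable {W Wd : WeierstrassCurve ℚ} [W.IsElliptic] [Wd.IsElliptic] {p : ℕ} [Fact p.Prime]

/-! ### Complex conjugation fixes `√d` for `d > 0` -/

/-- **Complex conjugation fixes `√d` for `d > 0`.** Under an embedding `ι : ℚ̄ → ℂ` realising `c` as
complex conjugation, `c√d = -√d` would make `ι(√d)` purely imaginary, with square `≤ 0`, whereas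
`ι(√d)² = d > 0`. [folklore] -/
theorem smul_geomSqrt_eq_of_isComplexConjugation_of_pos {d : ℚ} (hd : 0 < d)
    {c : absoluteGaloisGroup ℚ} (hc : IsComplexConjugation (Rat.castHom ℝ) c) :
    c • geomSqrt d = geomSqrt d := by
  rcases smul_geomSqrt_eq_or c d with h | h
  · exact h
  exfalso
  obtain ⟨ι, hι, hιc⟩ := isComplexConjugation_iff.mp hc
  set z : ℂ := ι (geomSqrt d) with hz
  have himag : starRingEnd ℂ z = -z := by rw [hz, ← hιc, h, map_neg]
  have hsq : z ^ 2 = ((d : ℝ) : ℂ) := by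
    rw [hz, ← map_pow, geomSqrt_sq]
    have h' := RingHom.congr_fun hι d
    simp only [RingHom.coe_comp, Function.comp_apply] at h'
    rw [h']
    simp
  have hre : z.re = 0 := by
    have h1 := congrArg Complex.re himag
    rw [Complex.conj_re, Complex.neg_re] at h1
    linarith
  have hre2 : (z ^ 2).re = z.re * z.re - z.im * z.im := by rw [pow_two, Complex.mul_re]
  rw [hsq, hre, mul_zero, zero_sub, Complex.ofReal_re] at hre2
  have h0 : (d : ℝ) ≤ 0 := by rw [hre2]; exact neg_nonpos.mpr (mul_self_nonneg _)
  have h1 : (0 : ℝ) < (d : ℝ) := by exact_mod_cast hd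
  exact absurd h0 (not_le.mpr h1)

/-! ### Lines along an equivalence `E'[p] ≃ E[p]` that is `Γ_ℚ`-equivariant up to a sign -/

section SignEquiv

variable (e : geomTorsion Wd (p : ℤ) ≃+ geomTorsion W (p : ℤ)) (ε : absoluteGaloisGroup ℚ → Prop)
  (hpos : ∀ σ, ε σ → ∀ T, e (σ • T) = σ • e T)
  (hneg : ∀ σ, ¬ ε σ → ∀ T, e (σ • T) = -(σ • e T))

omit [W.IsElliptic] [Wd.IsElliptic] in
include hpos hneg in
/-- Along a group isomorphism `e : E'[p] ≃ E[p]` with `e(σT) = ±σ e(T)` (sign depending on `σ`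
only), the image of a rational line is a rational line. [folklore] -/
theorem isRationalLine_map_signEquiv {Ψ : AddSubgroup (geomTorsion Wd (p : ℤ))}
    (hΨ : IsRationalLine Wd p Ψ) : IsRationalLine W p (Ψ.map e.toAddMonoidHom) := by
  refine ⟨?_, ?_⟩
  · exact (Nat.card_congr (Ψ.equivMapOfInjective e.toAddMonoidHom e.injective).toEquiv).symm.trans hΨ.1
  · intro σ S hS
    rw [AddSubgroup.mem_map] at hS ⊢
    obtain ⟨T, hT, rfl⟩ := hS
    by_cases hσ : ε σ
    · exact ⟨σ • T, hΨ.2 σ T hT, hpos σ hσ T⟩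
    · refine ⟨-(σ • T), neg_mem (hΨ.2 σ T hT), ?_⟩
      change e (-(σ • T)) = σ • e T
      rw [map_neg, hneg σ hσ T, neg_neg]

omit [W.IsElliptic] [Wd.IsElliptic] in
include hpos in
/-- If every element of every inertia group above `p` has sign `+` (`ε σ`), the image line is
unramified at `p` iff the line is. [folklore] -/
theorem lineUnramifiedAt_map_signEquiv_iff
    (hI : ∀ (v : HeightOneSpectrum (𝓞 ℚ)), (p : 𝓞 ℚ) ∈ v.asIdeal → ∀ 𝔓 ∈ v.primesAbove,
      ∀ σ ∈ 𝔓.inertia (absoluteGaloisGroup ℚ), ε σ)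
    (Ψ : AddSubgroup (geomTorsion Wd (p : ℤ))) :
    LineUnramifiedAt W p (Ψ.map e.toAddMonoidHom) ↔ LineUnramifiedAt Wd p Ψ := by
  constructor
  · intro h v hv 𝔓 h𝔓 σ hσ T hT
    have h1 := h v hv 𝔓 h𝔓 σ hσ (e T) (AddSubgroup.mem_map.mpr ⟨T, hT, rfl⟩)
    rw [← hpos σ (hI v hv 𝔓 h𝔓 σ hσ) T] at h1
    exact e.injective h1
  · intro h v hv 𝔓 h𝔓 σ hσ S hS
    obtain ⟨T, hT, rfl⟩ := AddSubgroup.mem_map.mp hS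
    change σ • e T = e T
    rw [← hpos σ (hI v hv 𝔓 h𝔓 σ hσ) T, h v hv 𝔓 h𝔓 σ hσ T hT]

omit [W.IsElliptic] [Wd.IsElliptic] in
include hpos in
/-- If every complex conjugation has sign `+`, parity is preserved: even ↔ even. [folklore] -/
theorem lineEven_map_signEquiv_iff_of_pos
    (hc : ∀ c : absoluteGaloisGroup ℚ, IsComplexConjugation (Rat.castHom ℝ) c → ε c)
    (Ψ : AddSubgroup (geomTorsion Wd (p : ℤ))) :
    LineEven W p (Ψ.map e.toAddMonoidHom) ↔ LineEven Wd p Ψ := by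
  constructor
  · intro h c hcc T hT
    have h1 := h c hcc (e T) (AddSubgroup.mem_map.mpr ⟨T, hT, rfl⟩)
    rw [← hpos c (hc c hcc) T] at h1
    exact e.injective h1
  · intro h c hcc S hS
    obtain ⟨T, hT, rfl⟩ := AddSubgroup.mem_map.mp hS
    change c • e T = e T
    rw [← hpos c (hc c hcc) T, h c hcc T hT]

omit [W.IsElliptic] [Wd.IsElliptic] in
include hpos in
/-- If every complex conjugation has sign `+`, parity is preserved: odd ↔ odd. [folklore] -/
theorem lineOdd_map_signEquiv_iff_of_pos
    (hc : ∀ c : absoluteGaloisGroup ℚ, IsComplexConjugation (Rat.castHom ℝ) c → ε c)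
    (Ψ : AddSubgroup (geomTorsion Wd (p : ℤ))) :
    LineOdd W p (Ψ.map e.toAddMonoidHom) ↔ LineOdd Wd p Ψ := by
  constructor
  · intro h c hcc T hT
    have h1 := h c hcc (e T) (AddSubgroup.mem_map.mpr ⟨T, hT, rfl⟩)
    rw [← hpos c (hc c hcc) T, ← map_neg] at h1
    exact e.injective h1
  · intro h c hcc S hS
    obtain ⟨T, hT, rfl⟩ := AddSubgroup.mem_map.mp hS
    change c • e T = -e T
    rw [← hpos c (hc c hcc) T, h c hcc T hT, map_neg]

omit [W.IsElliptic] [Wd.IsElliptic] in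
include hneg in
/-- If every complex conjugation has sign `−`, parity is swapped: the image is even iff the line
is odd. [folklore] -/
theorem lineEven_map_signEquiv_iff_of_neg
    (hc : ∀ c : absoluteGaloisGroup ℚ, IsComplexConjugation (Rat.castHom ℝ) c → ¬ ε c)
    (Ψ : AddSubgroup (geomTorsion Wd (p : ℤ))) :
    LineEven W p (Ψ.map e.toAddMonoidHom) ↔ LineOdd Wd p Ψ := by
  constructor
  · intro h c hcc T hT
    have h1 := h c hcc (e T) (AddSubgroup.mem_map.mpr ⟨T, hT, rfl⟩)
    -- `c • e T = e T` and `e (c • T) = -(c • e T)`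
    have h2 : e (c • T) = e (-T) := by rw [hneg c (hc c hcc) T, h1, map_neg]
    exact e.injective h2
  · intro h c hcc S hS
    obtain ⟨T, hT, rfl⟩ := AddSubgroup.mem_map.mp hS
    change c • e T = e T
    have h2 : e (c • T) = -(c • e T) := hneg c (hc c hcc) T
    rw [h c hcc T hT, map_neg] at h2
    exact (neg_inj.mp h2).symm

omit [W.IsElliptic] [Wd.IsElliptic] in
include hneg in
/-- If every complex conjugation has sign `−`, parity is swapped: the image is odd iff the line
is even. [folklore] -/
theorem lineOdd_map_signEquiv_iff_of_neg
    (hc : ∀ c : absoluteGaloisGroup ℚ, IsComplexConjugation (Rat.castHom ℝ) c → ¬ ε c)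
    (Ψ : AddSubgroup (geomTorsion Wd (p : ℤ))) :
    LineOdd W p (Ψ.map e.toAddMonoidHom) ↔ LineEven Wd p Ψ := by
  constructor
  · intro h c hcc T hT
    have h1 := h c hcc (e T) (AddSubgroup.mem_map.mpr ⟨T, hT, rfl⟩)
    have h2 : e (c • T) = e T := by rw [hneg c (hc c hcc) T, h1, neg_neg]
    exact e.injective h2
  · intro h c hcc S hS
    obtain ⟨T, hT, rfl⟩ := AddSubgroup.mem_map.mp hS
    change c • e T = -e T
    have h2 : e (c • T) = -(c • e T) := hneg c (hc c hcc) T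
    rw [h c hcc T hT] at h2
    -- `h2 : e T = -(c • e T)`
    exact (neg_eq_iff_eq_neg.mpr h2).symm

omit [W.IsElliptic] [Wd.IsElliptic] [Fact p.Prime] in
/-- Every subgroup of `E[p]` is the image under `e` of its preimage. [folklore] -/
theorem map_comap_signEquiv (Φ : AddSubgroup (geomTorsion W (p : ℤ))) :
    (Φ.map e.symm.toAddMonoidHom).map e.toAddMonoidHom = Φ := by
  ext S
  simp only [AddSubgroup.mem_map, AddEquiv.coe_toAddMonoidHom]
  constructor
  · rintro ⟨T, ⟨S', hS', rfl⟩, rfl⟩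
    simpa using hS'
  · intro hS
    exact ⟨e.symm S, ⟨S, hS, rfl⟩, by simp⟩

end SignEquiv

/-! ### The twist equivalence `E^{(d)}[p] ≃ E[p]` -/

omit [W.IsElliptic] [Wd.IsElliptic] [Fact p.Prime] in
/-- **The sign-equivariant identification `E^{(d)}[p] ≃ E[p]`** for any model `Wd` of the quadratic
twist (`C • Wd = W.quadraticTwist d`, `d ≠ 0`): `e(σT) = σ e(T)` if `σ√d = √d` and
`e(σT) = -σ e(T)` if `σ√d = -√d` (Silverman *AEC* X.5 Cor. 5.4; tree
`exists_addEquiv_geomPoints_quadraticTwist_sign` composed with the change of model, as in gen 1's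
`gvPar_of_not_gvPar_of_twist`). [cite: SilvermanAEC2009, X.5 Cor. 5.4] -/
theorem exists_signEquiv_of_twist {d : ℚ} (hd0 : d ≠ 0) (C : VariableChange ℚ)
    (hC : C • Wd = W.quadraticTwist d) :
    ∃ e : geomTorsion Wd (p : ℤ) ≃+ geomTorsion W (p : ℤ),
      (∀ σ : absoluteGaloisGroup ℚ, σ • geomSqrt d = geomSqrt d → ∀ T, e (σ • T) = σ • e T) ∧
      (∀ σ : absoluteGaloisGroup ℚ, ¬ σ • geomSqrt d = geomSqrt d → ∀ T, e (σ • T) = -(σ • e T)) := by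
  obtain ⟨f, hfpos, hfneg⟩ := W.exists_addEquiv_geomPoints_quadraticTwist_sign hd0
  let e₁ : Wd.geomPoints ≃+ (C • Wd).geomPoints :=
    VariableChange.pointEquivBaseChange Wd C (AlgebraicClosure ℚ)
  let e₂ : (C • Wd).geomPoints ≃+ (W.quadraticTwist d).geomPoints :=
    Affine.Point.congrEquiv (congrArg (fun Z : WeierstrassCurve ℚ ↦ Z.baseChange (AlgebraicClosure ℚ)) hC)
  have h₁ : ∀ (σ : absoluteGaloisGroup ℚ) (P : Wd.geomPoints), e₁ (σ • P) = σ • e₁ P := fun σ P ↦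
    VariableChange.pointEquivBaseChange_map_algEquiv Wd C (absoluteGaloisGroup.toAlgEquiv ℚ σ) P
  have h₂ : ∀ (σ : absoluteGaloisGroup ℚ) (P : (C • Wd).geomPoints), e₂ (σ • P) = σ • e₂ P :=
    fun σ P ↦ congrEquiv_smul_of_eq hC (absoluteGaloisGroup.toAlgEquiv ℚ σ) P
  set F : Wd.geomPoints ≃+ W.geomPoints := (e₁.trans e₂).trans f with hF
  have hFpos : ∀ σ : absoluteGaloisGroup ℚ, σ • geomSqrt d = geomSqrt d → ∀ P, F (σ • P) = σ • F P := by
    intro σ hσ P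
    simp only [hF, AddEquiv.trans_apply]
    rw [h₁, h₂, hfpos σ hσ]
  have hFneg : ∀ σ : absoluteGaloisGroup ℚ, σ • geomSqrt d = -geomSqrt d → ∀ P, F (σ • P) = -(σ • F P) := by
    intro σ hσ P
    simp only [hF, AddEquiv.trans_apply]
    rw [h₁, h₂, hfneg σ hσ]
  have hmem : ∀ T : geomTorsion Wd (p : ℤ), F T ∈ geomTorsion W (p : ℤ) := by
    intro T
    rw [AddSubgroup.torsionBy.nsmul_iff, ← map_nsmul, AddSubgroup.torsionBy.nsmul_iff.mp T.2,
      map_zero]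
  let φ : geomTorsion Wd (p : ℤ) →+ geomTorsion W (p : ℤ) :=
    AddMonoidHom.codRestrict ((F : Wd.geomPoints →+ W.geomPoints).comp
      (geomTorsion Wd (p : ℤ)).subtype) (geomTorsion W (p : ℤ)) hmem
  have hφ : ∀ T, ((φ T : geomTorsion W (p : ℤ)) : W.geomPoints) = F T := fun T ↦ rfl
  have hφinj : Function.Injective φ := by
    intro T₁ T₂ h
    have h' := congrArg (fun S : geomTorsion W (p : ℤ) ↦ (S : W.geomPoints)) h
    simp only [hφ] at h'
    exact Subtype.ext (F.injective h')
  have hφsurj : Function.Surjective φ := by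
    intro S
    have hS : F.symm S ∈ geomTorsion Wd (p : ℤ) := by
      rw [AddSubgroup.torsionBy.nsmul_iff]
      apply F.injective
      rw [map_nsmul, AddEquiv.apply_symm_apply, map_zero]
      exact AddSubgroup.torsionBy.nsmul_iff.mp S.2
    refine ⟨⟨F.symm S, hS⟩, Subtype.ext ?_⟩
    rw [hφ]
    exact F.apply_symm_apply S
  refine ⟨AddEquiv.ofBijective φ ⟨hφinj, hφsurj⟩, ?_, ?_⟩
  · intro σ hσ T
    exact Subtype.ext (by
      rw [AddSubgroup.torsionBy.coe_smul]
      change F (((σ • T : geomTorsion Wd (p : ℤ))) : Wd.geomPoints) = σ • F T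
      rw [AddSubgroup.torsionBy.coe_smul, hFpos σ hσ])
  · intro σ hσ T
    have hσ' : σ • geomSqrt d = -geomSqrt d := (smul_geomSqrt_eq_or σ d).resolve_left hσ
    exact Subtype.ext (by
      rw [AddSubgroup.coe_neg, AddSubgroup.torsionBy.coe_smul]
      change F (((σ • T : geomTorsion Wd (p : ℤ))) : Wd.geomPoints) = -(σ • F T)
      rw [AddSubgroup.torsionBy.coe_smul, hFneg σ hσ'])

/-- `p ∤ d`, `p` odd ⇒ `p ∤ 4d`. [folklore] -/
theorem not_dvd_four_mul (hp2 : p ≠ 2) {d : ℤ} (hpd : ¬ (p : ℤ) ∣ d) : ¬ (p : ℤ) ∣ 4 * d := by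
  have hp : p.Prime := Fact.out
  intro h
  rcases (Nat.prime_iff_prime_int.mp hp).dvd_or_dvd h with h4 | h4
  · have : (p : ℤ) ∣ 2 * 2 := by simpa [show (4 : ℤ) = 2 * 2 by norm_num] using h4
    rcases (Nat.prime_iff_prime_int.mp hp).dvd_or_dvd this with h2 | h2 <;>
    · have := Int.le_of_dvd two_pos h2
      have h1 := hp.two_le
      have : (p : ℤ) = 2 := by omega
      exact hp2 (by exact_mod_cast this)
  · exact hpd h4

/-! ### Even twists preserve the type -/

omit [W.IsElliptic] [Wd.IsElliptic] in
/-- **An even quadratic twist unramified at `p` preserves the Greenberg–Vatsal type.** For `p` odd,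
`d > 0` an integer with `p ∤ d`, and any model `Wd` of `E^{(d)}` (`C • Wd = W.quadraticTwist d`):
`GVPar Wd p ↔ GVPar W p`. No reduction hypothesis. (Greenberg–Vatsal 2000, after Thm. 1.3: "The
hypotheses are also preserved by even quadratic twists of conductor prime to `p`".)
[cite: GreenbergVatsal2000, remark after Thm. (1.3)] -/
theorem gvPar_twist_iff_of_pos (hp2 : p ≠ 2) {d : ℤ} (hd : 0 < d) (hpd : ¬ (p : ℤ) ∣ d)
    (C : VariableChange ℚ) (hC : C • Wd = W.quadraticTwist ((d : ℤ) : ℚ)) :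
    GVPar Wd p ↔ GVPar W p := by
  have hd0 : ((d : ℤ) : ℚ) ≠ 0 := by exact_mod_cast hd.ne'
  have hdpos : (0 : ℚ) < ((d : ℤ) : ℚ) := by exact_mod_cast hd
  obtain ⟨e, hpos, hneg⟩ := exists_signEquiv_of_twist (W := W) (Wd := Wd) (p := p) hd0 C hC
  have hI : ∀ (v : HeightOneSpectrum (𝓞 ℚ)), (p : 𝓞 ℚ) ∈ v.asIdeal → ∀ 𝔓 ∈ v.primesAbove,
      ∀ σ ∈ 𝔓.inertia (absoluteGaloisGroup ℚ), σ • geomSqrt ((d : ℤ) : ℚ) = geomSqrt ((d : ℤ) : ℚ) :=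
    fun v hv 𝔓 h𝔓 σ hσ ↦ smul_geomSqrt_eq_of_mem_inertia (p := p) (not_dvd_four_mul hp2 hpd) hv h𝔓 hσ
  have hcc : ∀ c : absoluteGaloisGroup ℚ, IsComplexConjugation (Rat.castHom ℝ) c →
      c • geomSqrt ((d : ℤ) : ℚ) = geomSqrt ((d : ℤ) : ℚ) :=
    fun c hc ↦ smul_geomSqrt_eq_of_isComplexConjugation_of_pos hdpos hc
  -- types correspond along `Ψ ↦ e Ψ`
  have key : ∀ Ψ : AddSubgroup (geomTorsion Wd (p : ℤ)),
      ((¬ LineUnramifiedAt W p (Ψ.map e.toAddMonoidHom) ∧ LineEven W p (Ψ.map e.toAddMonoidHom)) ∨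
        (LineUnramifiedAt W p (Ψ.map e.toAddMonoidHom) ∧ LineOdd W p (Ψ.map e.toAddMonoidHom))) ↔
      ((¬ LineUnramifiedAt Wd p Ψ ∧ LineEven Wd p Ψ) ∨ (LineUnramifiedAt Wd p Ψ ∧ LineOdd Wd p Ψ)) := by
    intro Ψ
    rw [lineUnramifiedAt_map_signEquiv_iff e _ hpos hI, lineEven_map_signEquiv_iff_of_pos e _ hpos hcc,
      lineOdd_map_signEquiv_iff_of_pos e _ hpos hcc]
  constructor
  · rintro ⟨Ψ, hΨ, hQ⟩
    exact ⟨Ψ.map e.toAddMonoidHom, isRationalLine_map_signEquiv e _ hpos hneg hΨ, (key Ψ).mpr hQ⟩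
  · rintro ⟨Φ, hΦ, hQ⟩
    refine ⟨Φ.map e.symm.toAddMonoidHom, ?_, ?_⟩
    · -- rationality of the preimage: transport back along `e.symm`, which has the same signs
      refine isRationalLine_map_signEquiv e.symm (fun σ ↦ σ • geomSqrt ((d : ℤ) : ℚ) = geomSqrt ((d : ℤ) : ℚ))
        (fun σ hσ S ↦ ?_) (fun σ hσ S ↦ ?_) hΦ
      · apply e.injective
        rw [AddEquiv.apply_symm_apply, hpos σ hσ, AddEquiv.apply_symm_apply]
      · apply e.injective
        rw [AddEquiv.apply_symm_apply, map_neg, hneg σ hσ, AddEquiv.apply_symm_apply, neg_neg]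
    · rw [← key, map_comap_signEquiv]
      exact hQ

/-! ### Odd twists swap the type -/

omit [W.IsElliptic] [Wd.IsElliptic] in
/-- **An odd quadratic twist unramified at `p` exchanges Greenberg–Vatsal type and co-type of
lines.** For `p` odd, `d < 0` with `p ∤ d` and `C • Wd = W.quadraticTwist d`: `GVPar Wd p` iff
`E` has a rational line of co-type ((unramified ∧ even) ∨ (ramified ∧ odd)). No reduction
hypothesis. [cite: CastellaEtAl2021, proof of Thm. 5.3.1 (last paragraph)] -/
theorem gvPar_twist_iff_exists_coType_of_neg (hp2 : p ≠ 2) {d : ℤ} (hd : d < 0)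
    (hpd : ¬ (p : ℤ) ∣ d) (C : VariableChange ℚ) (hC : C • Wd = W.quadraticTwist ((d : ℤ) : ℚ)) :
    GVPar Wd p ↔ ∃ Φ : AddSubgroup (geomTorsion W (p : ℤ)), IsRationalLine W p Φ ∧
      ((LineUnramifiedAt W p Φ ∧ LineEven W p Φ) ∨ (¬ LineUnramifiedAt W p Φ ∧ LineOdd W p Φ)) := by
  have hd0 : ((d : ℤ) : ℚ) ≠ 0 := by exact_mod_cast hd.ne
  have hdneg : ((d : ℤ) : ℚ) < 0 := by exact_mod_cast hd
  obtain ⟨e, hpos, hneg⟩ := exists_signEquiv_of_twist (W := W) (Wd := Wd) (p := p) hd0 C hC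
  have hI : ∀ (v : HeightOneSpectrum (𝓞 ℚ)), (p : 𝓞 ℚ) ∈ v.asIdeal → ∀ 𝔓 ∈ v.primesAbove,
      ∀ σ ∈ 𝔓.inertia (absoluteGaloisGroup ℚ), σ • geomSqrt ((d : ℤ) : ℚ) = geomSqrt ((d : ℤ) : ℚ) :=
    fun v hv 𝔓 h𝔓 σ hσ ↦ smul_geomSqrt_eq_of_mem_inertia (p := p) (not_dvd_four_mul hp2 hpd) hv h𝔓 hσ
  have hcc : ∀ c : absoluteGaloisGroup ℚ, IsComplexConjugation (Rat.castHom ℝ) c →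
      ¬ c • geomSqrt ((d : ℤ) : ℚ) = geomSqrt ((d : ℤ) : ℚ) := by
    intro c hc h
    have h' := smul_geomSqrt_eq_neg_of_isComplexConjugation hdneg hc
    rw [h] at h'
    -- `√d = -√d` forces `√d = 0`, contradicting `d ≠ 0`
    have h2 : (2 : AlgebraicClosure ℚ) * geomSqrt ((d : ℤ) : ℚ) = 0 := by linear_combination h'
    have hs : geomSqrt ((d : ℤ) : ℚ) = 0 := by
      rcases mul_eq_zero.mp h2 with h2' | h2'
      · exact absurd h2' two_ne_zero
      · exact h2'
    have := geomSqrt_sq ((d : ℤ) : ℚ)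
    rw [hs, zero_pow two_ne_zero] at this
    exact hd0 (by
      have h3 : (algebraMap ℚ (AlgebraicClosure ℚ)) ((d : ℤ) : ℚ) = 0 := this.symm
      exact (map_eq_zero _).mp h3)
  have key : ∀ Ψ : AddSubgroup (geomTorsion Wd (p : ℤ)),
      ((LineUnramifiedAt W p (Ψ.map e.toAddMonoidHom) ∧ LineEven W p (Ψ.map e.toAddMonoidHom)) ∨
        (¬ LineUnramifiedAt W p (Ψ.map e.toAddMonoidHom) ∧ LineOdd W p (Ψ.map e.toAddMonoidHom))) ↔
      ((¬ LineUnramifiedAt Wd p Ψ ∧ LineEven Wd p Ψ) ∨ (LineUnramifiedAt Wd p Ψ ∧ LineOdd Wd p Ψ)) := by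
    intro Ψ
    rw [lineUnramifiedAt_map_signEquiv_iff e _ hpos hI, lineEven_map_signEquiv_iff_of_neg e _ hneg hcc,
      lineOdd_map_signEquiv_iff_of_neg e _ hneg hcc, or_comm]
  constructor
  · rintro ⟨Ψ, hΨ, hQ⟩
    exact ⟨Ψ.map e.toAddMonoidHom, isRationalLine_map_signEquiv e _ hpos hneg hΨ, (key Ψ).mpr hQ⟩
  · rintro ⟨Φ, hΦ, hQ⟩
    refine ⟨Φ.map e.symm.toAddMonoidHom, ?_, ?_⟩
    · refine isRationalLine_map_signEquiv e.symm (fun σ ↦ σ • geomSqrt ((d : ℤ) : ℚ) = geomSqrt ((d : ℤ) : ℚ))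
        (fun σ hσ S ↦ ?_) (fun σ hσ S ↦ ?_) hΦ
      · apply e.injective
        rw [AddEquiv.apply_symm_apply, hpos σ hσ, AddEquiv.apply_symm_apply]
      · apply e.injective
        rw [AddEquiv.apply_symm_apply, map_neg, hneg σ hσ, AddEquiv.apply_symm_apply, neg_neg]
    · rw [← key, map_comap_signEquiv]
      exact hQ

omit [W.IsElliptic] in
/-- A rational line is not both even and odd (`p` odd): a non-zero point `Q` of it would satisfy
`Q = -Q`, i.e. `2Q = 0`. [folklore] -/
theorem lineEven_lineOdd_false (hp2 : p ≠ 2) {Φ : AddSubgroup (geomTorsion W (p : ℤ))}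
    (hΦ : IsRationalLine W p Φ) (he : LineEven W p Φ) (ho : LineOdd W p Φ) : False := by
  have hp : p.Prime := Fact.out
  obtain ⟨c, hcc⟩ := exists_isComplexConjugation (Rat.castHom ℝ)
  haveI : Finite Φ := Nat.finite_of_card_ne_zero (by rw [hΦ.1]; exact hp.ne_zero)
  have hnt : 1 < Nat.card Φ := by rw [hΦ.1]; exact hp.one_lt
  haveI : Nontrivial Φ := Finite.one_lt_card_iff_nontrivial.mp hnt
  obtain ⟨⟨Q, hQΦ⟩, hQ0⟩ := exists_ne (0 : Φ)
  have h1 : c • Q = Q := he c hcc Q hQΦ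
  have h2 : c • Q = -Q := ho c hcc Q hQΦ
  rw [h1] at h2
  apply hQ0
  apply Subtype.ext
  refine eq_zero_of_add_self_eq_zero hp2 ?_
  change Q + Q = 0
  nth_rewrite 2 [h2]
  exact add_neg_cancel Q

omit [Wd.IsElliptic] in
/-- **At a good ordinary odd `p` an odd twist unramified at `p` swaps type A and type B** (globally
minimal `W` with `E[p]` reducible, `d < 0`, `p ∤ d`, `C • Wd = W.quadraticTwist d`):
`GVPar Wd p ↔ ¬ GVPar W p`. The iff form of gen 1's `gvPar_of_not_gvPar_of_twist` — the TWIST LAW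
"`E ↦ E^K` swaps A ↔ B" of CGLS §5 / X1-CENSUS-g2.md §0 (`→`: a co-type line makes `E` of type A,
`not_gvPar_of_isRationalLine`; `←`: `coType_of_not_gvPar`). [cite: CastellaEtAl2021, proof of Thm. 5.3.1] -/
theorem gvPar_twist_iff_not_gvPar_of_neg [W.IsGloballyMinimal] (hp2 : p ≠ 2)
    (hgood : W.HasGoodReductionAtPrime p) (hord : ¬ (p : ℤ) ∣ W.frobeniusTrace p)
    (hred : ¬ W.HasIrreducibleModPGaloisRep p) {d : ℤ} (hd : d < 0) (hpd : ¬ (p : ℤ) ∣ d)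
    (C : VariableChange ℚ) (hC : C • Wd = W.quadraticTwist ((d : ℤ) : ℚ)) :
    GVPar Wd p ↔ ¬ GVPar W p := by
  rw [gvPar_twist_iff_exists_coType_of_neg hp2 hd hpd C hC]
  constructor
  · rintro ⟨Φ, hΦ, hQ⟩
    refine not_gvPar_of_isRationalLine hp2 hgood hord hΦ ?_
    rintro (⟨hr, he⟩ | ⟨hu, ho⟩)
    · rcases hQ with ⟨hu', -⟩ | ⟨-, ho'⟩
      · exact hr hu'
      · exact lineEven_lineOdd_false hp2 hΦ he ho'
    · rcases hQ with ⟨-, he'⟩ | ⟨hr', -⟩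
      · exact lineEven_lineOdd_false hp2 hΦ he' ho
      · exact hr' hu
  · intro hA
    obtain ⟨Φ, hΦ⟩ := exists_isRationalLine_of_not_irr W p hred
    exact ⟨Φ, hΦ, coType_of_not_gvPar hΦ hA⟩

/-! ### A rational line passes along an isogeny not killing `E[p]` -/

/-- **Reducibility passes along an isogeny not killing `E[p]`.** If `f : E₁ → E₂` is a `ℚ`-isogeny
with `E₁[p] ⊄ ker f` and `Φ ≤ E₁[p]` a rational line, then `E₂[p]` has a rational line: the image
of `Φ` if `f` is injective on `Φ`, else the image `f(E₁[p]) ≅ E₁[p]/Φ` (the case analysis of gen 2's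
`gvPar_of_isogeny`). [folklore] -/
theorem exists_isRationalLine_of_isogeny {W₁ W₂ : WeierstrassCurve ℚ} [W₁.IsElliptic]
    (f : Isogeny W₁ W₂) (hf : ∃ P : geomPoints W₁, P ∈ geomTorsion W₁ (p : ℤ) ∧ f P ≠ 0)
    {Φ : AddSubgroup (geomTorsion W₁ (p : ℤ))} (hΦ : IsRationalLine W₁ p Φ) :
    ∃ Ψ : AddSubgroup (geomTorsion W₂ (p : ℤ)), IsRationalLine W₂ p Ψ := by
  have hp : p.Prime := Fact.out
  have hmem : ∀ P : geomTorsion W₁ (p : ℤ), f (P : geomPoints W₁) ∈ geomTorsion W₂ (p : ℤ) := by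
    intro P
    have h0 : (p : ℤ) • (P : geomPoints W₁) = 0 := (Submodule.mem_torsionBy_iff (p : ℤ) _).mp P.2
    have h1 : (p : ℤ) • f (P : geomPoints W₁) = 0 := by rw [← map_zsmul, h0, map_zero]
    exact (Submodule.mem_torsionBy_iff (p : ℤ) _).mpr h1
  let g : geomTorsion W₁ (p : ℤ) →+ geomTorsion W₂ (p : ℤ) :=
    { toFun := fun P ↦ ⟨f (P : geomPoints W₁), hmem P⟩
      map_zero' := Subtype.ext (by simp)
      map_add' := fun P Q ↦ Subtype.ext (by simp) }
  have hgval : ∀ P : geomTorsion W₁ (p : ℤ), (g P : geomPoints W₂) = f (P : geomPoints W₁) :=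
    fun _ ↦ rfl
  have hg : ∀ (σ : absoluteGaloisGroup ℚ) (P : geomTorsion W₁ (p : ℤ)), g (σ • P) = σ • g P := by
    intro σ P
    apply Subtype.ext
    rw [hgval, AddSubgroup.torsionBy.coe_smul, AddSubgroup.torsionBy.coe_smul, hgval, f.map_smul]
  have hE : Nat.card (geomTorsion W₁ (p : ℤ)) = p ^ 2 := natCard_geomTorsion W₁ p
  haveI : Finite (geomTorsion W₁ (p : ℤ)) :=
    Nat.finite_of_card_ne_zero (by rw [hE]; exact pow_ne_zero 2 hp.ne_zero)
  by_cases hinj : ∀ P ∈ Φ, g P = 0 → P = 0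
  · exact ⟨Φ.map g, isRationalLine_map g hg hΦ hinj⟩
  · push Not at hinj
    obtain ⟨P₁, hP₁Φ, hP₁g, hP₁0⟩ := hinj
    have hP₁K : P₁ ∈ g.ker := (AddMonoidHom.mem_ker).mpr hP₁g
    have hdvd : Nat.card g.ker ∣ p ^ 2 := hE ▸ g.ker.card_addSubgroup_dvd_card
    obtain ⟨i, hi, hKi⟩ := (Nat.dvd_prime_pow hp).mp hdvd
    interval_cases i
    · exfalso
      have hbot : g.ker = ⊥ := AddSubgroup.card_eq_one.mp (by simpa using hKi)
      rw [hbot, AddSubgroup.mem_bot] at hP₁K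
      exact hP₁0 hP₁K
    · exact ⟨g.range, isRationalLine_range g hg hE (by simpa using hKi)⟩
    · exfalso
      have htop : g.ker = ⊤ := AddSubgroup.eq_top_of_card_eq _ (by rw [hKi, hE])
      obtain ⟨P, hP, hfP⟩ := hf
      have hmem1 : (⟨P, hP⟩ : geomTorsion W₁ (p : ℤ)) ∈ g.ker := by rw [htop]; exact AddSubgroup.mem_top _
      rw [AddMonoidHom.mem_ker] at hmem1
      exact hfP (by simpa [hgval] using congrArg Subtype.val hmem1)

/-- **`E[p]` reducible is a property of the `ℚ`-isogeny class** (elliptic curves over `ℚ`): along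
an isogeny not killing `E[p]` (`exists_isogeny_apply_ne_zero`) a rational line goes to a rational
line (`exists_isRationalLine_of_isogeny`). [folklore] -/
theorem not_hasIrreducibleModPGaloisRep_of_isIsogenous {W₁ W₂ : WeierstrassCurve ℚ}
    [W₁.IsElliptic] [W₂.IsElliptic] (h : IsIsogenous W₁ W₂)
    (hred : ¬ W₁.HasIrreducibleModPGaloisRep p) : ¬ W₂.HasIrreducibleModPGaloisRep p := by
  obtain ⟨f, P, hP, hfP⟩ := exists_isogeny_apply_ne_zero (p := p) h
  obtain ⟨Φ, hΦ⟩ := exists_isRationalLine_of_not_irr W₁ p hred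
  obtain ⟨Ψ, hΨ⟩ := exists_isRationalLine_of_isogeny f ⟨P, hP, hfP⟩ hΦ
  exact not_hasIrreducibleModPGaloisRep_of_isRationalLine hΨ

/-! ### Torsion certificates through a twist -/

variable (W) in
omit [W.IsElliptic] [Wd.IsElliptic] in
/-- **A rational point of order `p` on an ODD twist certifies type B.** For `p` odd, `d < 0` with
`p ∤ d`, a model `Wd` of `E^{(d)}` and `P ∈ E^{(d)}(ℚ)` of order `p`: `GVPar W p` — the line `ℤP` of
`E^{(d)}[p]` is fixed by `Γ_ℚ` (unramified, even), so its image in `E[p]` is a rational line which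
is unramified and ODD: of Greenberg–Vatsal type. No hypothesis on `E`. (Census: the 37 type-B
classes, whose unramified constituent is an odd character — at `p = 3` an imaginary quadratic
`χ_d`.) [folklore] -/
theorem gvPar_of_twist_neg_of_nsmul_eq_zero (hp2 : p ≠ 2) {d : ℤ} (hd : d < 0)
    (hpd : ¬ (p : ℤ) ∣ d) (C : VariableChange ℚ) (hC : C • Wd = W.quadraticTwist ((d : ℤ) : ℚ))
    (P : Wd.toAffine.Point) (hP0 : P ≠ 0) (hpP : p • P = 0) : GVPar W p := by
  have hd0 : ((d : ℤ) : ℚ) ≠ 0 := by exact_mod_cast hd.ne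
  have hdneg : ((d : ℤ) : ℚ) < 0 := by exact_mod_cast hd
  obtain ⟨e, hpos, hneg⟩ := exists_signEquiv_of_twist (W := W) (Wd := Wd) (p := p) hd0 C hC
  obtain ⟨Ψ, hΨ, hfix, hu, he⟩ := exists_isRationalLine_of_nsmul_eq_zero Wd P hP0 hpP
  have hI : ∀ (v : HeightOneSpectrum (𝓞 ℚ)), (p : 𝓞 ℚ) ∈ v.asIdeal → ∀ 𝔓 ∈ v.primesAbove,
      ∀ σ ∈ 𝔓.inertia (absoluteGaloisGroup ℚ), σ • geomSqrt ((d : ℤ) : ℚ) = geomSqrt ((d : ℤ) : ℚ) :=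
    fun v hv 𝔓 h𝔓 σ hσ ↦ smul_geomSqrt_eq_of_mem_inertia (p := p) (not_dvd_four_mul hp2 hpd) hv h𝔓 hσ
  have hcc : ∀ c : absoluteGaloisGroup ℚ, IsComplexConjugation (Rat.castHom ℝ) c →
      ¬ c • geomSqrt ((d : ℤ) : ℚ) = geomSqrt ((d : ℤ) : ℚ) := by
    intro c hc h
    have h' := smul_geomSqrt_eq_neg_of_isComplexConjugation hdneg hc
    rw [h] at h'
    have h2 : (2 : AlgebraicClosure ℚ) * geomSqrt ((d : ℤ) : ℚ) = 0 := by linear_combination h'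
    have hs : geomSqrt ((d : ℤ) : ℚ) = 0 := by
      rcases mul_eq_zero.mp h2 with h2' | h2'
      · exact absurd h2' two_ne_zero
      · exact h2'
    have := geomSqrt_sq ((d : ℤ) : ℚ)
    rw [hs, zero_pow two_ne_zero] at this
    exact hd0 ((map_eq_zero _).mp this.symm)
  refine ⟨Ψ.map e.toAddMonoidHom, isRationalLine_map_signEquiv e _ hpos hneg hΨ, Or.inr ⟨?_, ?_⟩⟩
  · exact (lineUnramifiedAt_map_signEquiv_iff e _ hpos hI Ψ).mpr hu
  · exact (lineOdd_map_signEquiv_iff_of_neg e _ hneg hcc Ψ).mpr he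

variable (W) in
omit [Wd.IsElliptic] in
/-- **A rational point of order `p` on an EVEN twist certifies type A** at a good ordinary odd `p`
(globally minimal `W`): for `d > 0` with `p ∤ d`, a model `Wd` of `E^{(d)}` and `P ∈ E^{(d)}(ℚ)` of
order `p`: `¬ GVPar W p` — the image of `ℤP` is a rational line of `E[p]` which is unramified and
EVEN, of co-type (`not_gvPar_of_isRationalLine`). (Census: the 49 type-A classes without rational
`p`-torsion, whose unramified constituent is a non-trivial even character — at `p = 3` a real
quadratic `χ_d`, `(d/3) = 1`.) [folklore] -/
theorem not_gvPar_of_twist_pos_of_nsmul_eq_zero [W.IsGloballyMinimal] (hp2 : p ≠ 2)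
    (hgood : W.HasGoodReductionAtPrime p) (hord : ¬ (p : ℤ) ∣ W.frobeniusTrace p)
    {d : ℤ} (hd : 0 < d) (hpd : ¬ (p : ℤ) ∣ d)
    (C : VariableChange ℚ) (hC : C • Wd = W.quadraticTwist ((d : ℤ) : ℚ))
    (P : Wd.toAffine.Point) (hP0 : P ≠ 0) (hpP : p • P = 0) : ¬ GVPar W p := by
  have hd0 : ((d : ℤ) : ℚ) ≠ 0 := by exact_mod_cast hd.ne'
  have hdpos : (0 : ℚ) < ((d : ℤ) : ℚ) := by exact_mod_cast hd
  obtain ⟨e, hpos, hneg⟩ := exists_signEquiv_of_twist (W := W) (Wd := Wd) (p := p) hd0 C hC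
  obtain ⟨Ψ, hΨ, hfix, hu, he⟩ := exists_isRationalLine_of_nsmul_eq_zero Wd P hP0 hpP
  have hI : ∀ (v : HeightOneSpectrum (𝓞 ℚ)), (p : 𝓞 ℚ) ∈ v.asIdeal → ∀ 𝔓 ∈ v.primesAbove,
      ∀ σ ∈ 𝔓.inertia (absoluteGaloisGroup ℚ), σ • geomSqrt ((d : ℤ) : ℚ) = geomSqrt ((d : ℤ) : ℚ) :=
    fun v hv 𝔓 h𝔓 σ hσ ↦ smul_geomSqrt_eq_of_mem_inertia (p := p) (not_dvd_four_mul hp2 hpd) hv h𝔓 hσ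
  have hcc : ∀ c : absoluteGaloisGroup ℚ, IsComplexConjugation (Rat.castHom ℝ) c →
      c • geomSqrt ((d : ℤ) : ℚ) = geomSqrt ((d : ℤ) : ℚ) :=
    fun c hc ↦ smul_geomSqrt_eq_of_isComplexConjugation_of_pos hdpos hc
  have hΦ : IsRationalLine W p (Ψ.map e.toAddMonoidHom) := isRationalLine_map_signEquiv e _ hpos hneg hΨ
  have hu' : LineUnramifiedAt W p (Ψ.map e.toAddMonoidHom) :=
    (lineUnramifiedAt_map_signEquiv_iff e _ hpos hI Ψ).mpr hu
  have he' : LineEven W p (Ψ.map e.toAddMonoidHom) :=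
    (lineEven_map_signEquiv_iff_of_pos e _ hpos hcc Ψ).mpr he
  refine not_gvPar_of_isRationalLine hp2 hgood hord hΦ ?_
  rintro (⟨hr, -⟩ | ⟨-, ho⟩)
  · exact hr hu'
  · exact lineEven_lineOdd_false hp2 hΦ he' ho

omit [W.IsElliptic] in
/-- **Type B by a rational `p`-torsion point on a curve ISOGENOUS to an odd twist.** `p` odd,
`d < 0`, `p ∤ d`; `Wd` a globally minimal model of `E^{(d)}` with good ordinary reduction at `p`,
`W''` globally minimal with good ordinary reduction at `p`, `IsIsogenous Wd W''`, and `P ∈ E''(ℚ)`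
of order `p`: then `GVPar W p`. (`E''` and `E^{(d)}` are of type A by the torsion criterion and
isogeny invariance, so `E^{(d)}` has a rational line of co-type (`E^{(d)}[p]` is reducible: it is
`E[p] ⊗ χ_d`), whose image in `E[p]` is of Greenberg–Vatsal type.) [folklore] -/
theorem gvPar_of_isIsogenous_twist_neg_of_nsmul_eq_zero {W'' : WeierstrassCurve ℚ} [W''.IsElliptic]
    [Wd.IsGloballyMinimal] [W''.IsGloballyMinimal] (hp2 : p ≠ 2) {d : ℤ} (hd : d < 0)
    (hpd : ¬ (p : ℤ) ∣ d) (C : VariableChange ℚ) (hC : C • Wd = W.quadraticTwist ((d : ℤ) : ℚ))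
    (hgood_d : Wd.HasGoodReductionAtPrime p) (hord_d : ¬ (p : ℤ) ∣ Wd.frobeniusTrace p)
    (hgood'' : W''.HasGoodReductionAtPrime p) (hord'' : ¬ (p : ℤ) ∣ W''.frobeniusTrace p)
    (hiso : IsIsogenous Wd W'') (P : W''.toAffine.Point) (hP0 : P ≠ 0) (hpP : p • P = 0) :
    GVPar W p := by
  -- `E''` is of type A, hence so is `E^{(d)}`
  have hA'' : ¬ GVPar W'' p := not_gvPar_of_nsmul_eq_zero W'' hp2 hgood'' hord'' P hP0 hpP
  have hAd : ¬ GVPar Wd p := fun h ↦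
    hA'' ((gvPar_iff_of_isIsogenous_of_not_dvd_frobeniusTrace hp2 hgood_d hord_d hgood'' hord'' hiso).mp h)
  -- a rational line of `E^{(d)}`: transport the `Γ`-fixed line of `E''` along an isogeny `E'' → E^{(d)}`
  -- not killing `E''[p]`... simpler: `E^{(d)}[p]` is reducible because `E''[p]` is and they are isogenous
  -- through an isogeny not killing the `p`-torsion (`exists_isogeny_apply_ne_zero`), whose restriction
  -- transports a rational line (`isRationalLine_map` / kernel-line case). We use the tree's
  -- reducibility transport instead: a rational line of `E''` gives one of `E^{(d)}`.
  obtain ⟨Ψ'', hΨ'', -, -, -⟩ := exists_isRationalLine_of_nsmul_eq_zero W'' P hP0 hpP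
  have hred'' : ¬ W''.HasIrreducibleModPGaloisRep p := not_hasIrreducibleModPGaloisRep_of_isRationalLine hΨ''
  have hredd : ¬ Wd.HasIrreducibleModPGaloisRep p :=
    not_hasIrreducibleModPGaloisRep_of_isIsogenous hiso.symm_of_charZero hred''
  obtain ⟨Ψ, hΨ⟩ := exists_isRationalLine_of_not_irr Wd p hredd
  have hco := coType_of_not_gvPar hΨ hAd
  -- transport `Ψ` to `E[p]` along the twist equivalence: co-type ↦ GV type (odd twist)
  have hd0 : ((d : ℤ) : ℚ) ≠ 0 := by exact_mod_cast hd.ne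
  have hdneg : ((d : ℤ) : ℚ) < 0 := by exact_mod_cast hd
  obtain ⟨e, hpos, hneg⟩ := exists_signEquiv_of_twist (W := W) (Wd := Wd) (p := p) hd0 C hC
  have hI : ∀ (v : HeightOneSpectrum (𝓞 ℚ)), (p : 𝓞 ℚ) ∈ v.asIdeal → ∀ 𝔓 ∈ v.primesAbove,
      ∀ σ ∈ 𝔓.inertia (absoluteGaloisGroup ℚ), σ • geomSqrt ((d : ℤ) : ℚ) = geomSqrt ((d : ℤ) : ℚ) :=
    fun v hv 𝔓 h𝔓 σ hσ ↦ smul_geomSqrt_eq_of_mem_inertia (p := p) (not_dvd_four_mul hp2 hpd) hv h𝔓 hσ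
  have hcc : ∀ c : absoluteGaloisGroup ℚ, IsComplexConjugation (Rat.castHom ℝ) c →
      ¬ c • geomSqrt ((d : ℤ) : ℚ) = geomSqrt ((d : ℤ) : ℚ) := by
    intro c hc h
    have h' := smul_geomSqrt_eq_neg_of_isComplexConjugation hdneg hc
    rw [h] at h'
    have h2 : (2 : AlgebraicClosure ℚ) * geomSqrt ((d : ℤ) : ℚ) = 0 := by linear_combination h'
    have hs : geomSqrt ((d : ℤ) : ℚ) = 0 := by
      rcases mul_eq_zero.mp h2 with h2' | h2'
      · exact absurd h2' two_ne_zero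
      · exact h2'
    have := geomSqrt_sq ((d : ℤ) : ℚ)
    rw [hs, zero_pow two_ne_zero] at this
    exact hd0 ((map_eq_zero _).mp this.symm)
  refine ⟨Ψ.map e.toAddMonoidHom, isRationalLine_map_signEquiv e _ hpos hneg hΨ, ?_⟩
  rw [lineUnramifiedAt_map_signEquiv_iff e _ hpos hI, lineEven_map_signEquiv_iff_of_neg e _ hneg hcc,
    lineOdd_map_signEquiv_iff_of_neg e _ hneg hcc]
  rcases hco with ⟨hu, he⟩ | ⟨hr, ho⟩
  · exact Or.inr ⟨hu, he⟩
  · exact Or.inl ⟨hr, ho⟩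

omit [W.IsElliptic] in
/-- **Type A by a rational `p`-torsion point on a curve ISOGENOUS to an even twist**, at a good
ordinary odd `p` (globally minimal `W`): `d > 0`, `p ∤ d`, `Wd` a globally minimal model of
`E^{(d)}` with good ordinary reduction at `p`, `W''` globally minimal good ordinary at `p` with
`IsIsogenous Wd W''` and `P ∈ E''(ℚ)` of order `p`: then `¬ GVPar W p`. [folklore] -/
theorem not_gvPar_of_isIsogenous_twist_pos_of_nsmul_eq_zero {W'' : WeierstrassCurve ℚ}
    [W''.IsElliptic] [W.IsGloballyMinimal] [Wd.IsGloballyMinimal] [W''.IsGloballyMinimal]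
    (hp2 : p ≠ 2) {d : ℤ} (hd : 0 < d) (hpd : ¬ (p : ℤ) ∣ d)
    (C : VariableChange ℚ) (hC : C • Wd = W.quadraticTwist ((d : ℤ) : ℚ))
    (hgood_d : Wd.HasGoodReductionAtPrime p) (hord_d : ¬ (p : ℤ) ∣ Wd.frobeniusTrace p)
    (hgood'' : W''.HasGoodReductionAtPrime p) (hord'' : ¬ (p : ℤ) ∣ W''.frobeniusTrace p)
    (hiso : IsIsogenous Wd W'') (P : W''.toAffine.Point) (hP0 : P ≠ 0) (hpP : p • P = 0) :
    ¬ GVPar W p := by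
  have hA'' : ¬ GVPar W'' p := not_gvPar_of_nsmul_eq_zero W'' hp2 hgood'' hord'' P hP0 hpP
  have hAd : ¬ GVPar Wd p := fun h ↦
    hA'' ((gvPar_iff_of_isIsogenous_of_not_dvd_frobeniusTrace hp2 hgood_d hord_d hgood'' hord'' hiso).mp h)
  rw [← gvPar_twist_iff_of_pos (W := W) (Wd := Wd) hp2 hd hpd C hC]
  exact hAd

end Literature.NumberTheory.EllipticCurves.Rank1Residual

end
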